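import Literature.NumberTheory.Transcendental.KZVolumeConjecture
import Literature.NumberTheory.Transcendental.KZDominatedFamilyRelations
import Literature.NumberTheory.Transcendental.PeriodCompactDomain
import HarnessLib

/-!
# Viu-Sos' semi-canonical reduction: the elementary steps (proof file)

Second proof file of `Literature/NumberTheory/Transcendental/KZVolumeConjecture.lean` (next to
`KZVolumeConjectureProofs.lean`, which derives the Cresson–Viu-Sos equivalence from the fact), for
the named fact `KZ.semiCanonicalReduction` [Viu-Sos 2021, Thm. 1.1]: *a non-zero real period
`p = ∫_S P/Q` can be rewritten, by the KZ-rules, as `sgn(p) · vol_m(K)` with `K ⊂ ℝ^m` compact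
top-dimensional semialgebraic, `0 < m ≤ d + 1`.*

The printed proof (arXiv:1509.01097, §§2–4) has four steps:

* (a) [Thm. 2.1 / Cor. 2.1] compactification of the domain: cover `ℙ^d(ℝ)` by `d + 1` cubes and
  change charts, so that `∫_S P/Q` is a finite sum of absolutely convergent rational integrals over
  *bounded* semialgebraic domains;
* (b) [Thm. 2.2 = Hironaka's embedded resolution, Prop. 2.2, Cor. 2.2] *separation of poles*: on a
  bounded domain, a finite sequence of blow-ups separates the strict transform of the domain from
  the pole locus of the pulled-back form, so that the integral becomes a finite sum of integrals of
  rational functions *without poles* on *compact* semialgebraic domains;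
* (c) [Cor. 2.3] split the domain by the sign of the integrand and take the region under the graph:
  `p = vol(K₁) − vol(K₂)` with `K₁, K₂ ⊂ ℝ^{d+1}` compact semialgebraic;
* (d) [§4, Lemmas 4.1–4.3] for `0 < vol(K₂) < vol(K₁)`: subdivide a box containing both sets into
  cubes of mesh `r/n`; for `n` large the number of cubes meeting `K₂` is at most the number of cubes
  inside `K₁` (inner and outer Riemann sums converge to the volumes); translating the former cubes
  onto the latter carries `K₂` (off the null grid walls) into `K₁` by a volume-preserving piecewise
  translation `Ψ`, and `K` is the closure of `K₁ ∖ Ψ(K₂)`.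

Steps (a), (c), (d) and all the bookkeeping (null sets, closures, compactness, non-empty interior,
dimension count) are proved here over the fixed calculus of moves of `KZCalculus.lean`. Step (b)
rests on Hironaka's resolution of singularities for real algebraic varieties, a theory the tree
does not have (the files `PeriodCompactDomain.lean`, `SemialgebraicVolumeComputable.lean`,
`SemialgebraicVolumeElementary.lean`, `FiniteVolumeElementary.lean` all take the same step as an
explicit hypothesis); accordingly the final theorems of this file,
`KZ.semiCanonicalReduction_of_boundedReduction` / `…_of_separationOfPoles`, derive
`KZ.semiCanonicalReduction` from step (b) ALONE, stated over the calculus (Viu-Sos' Cor. 2.2 for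
bounded input domains) and taken as an explicit hypothesis `H`. No definition and no named fact is
made (D-0026).

## Main statements (all proved; no definition, no named fact)

* `KZ.of_sub_of_mem_relations_of_null` — two representations whose domains differ by null sets
  and whose integrands agree on the common part differ by a relation;
* `KZ.of_sub_sum_of_mem_relations` — iterated domain additivity over a finite almost-partition;
* `KZ.exists_translate` — translation by a rational vector is a change-of-variables move;
* `KZ.exists_card_outerIdx_le_card_innerIdx` — Lemmas 4.1–4.2 of the source (cube counts);
* `KZ.exists_isCompact_of_sub_of_sub_mem_relations` — **step (d)** [Viu-Sos 2021, §4]: for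
  `K₁, K₂` with bounded domains, integrand `1` and `vol K₂ < vol K₁` there is `K` with compact
  domain of non-empty interior, integrand `1`, and `[K₁] − [K₂] − [K] ∈ relations`;
* `KZ.exists_underGraph`, `KZ.exists_sub_of_isBounded` — **step (c)**: the region under the graph
  of a non-negative integrand is one Newton–Leibniz move away; a bounded integrand on a bounded
  domain is, by the moves, a difference of two bounded volumes one dimension up;
* `KZ.exists_merge` — finitely many bounded volumes merge into one (disjoint translates);
* `KZ.exists_sub_sum_bounded_mem_relations` — **step (a)** [Viu-Sos 2021, Thm. 2.1] at the level
  of moves (the charts `inv T` of `PeriodCompactDomain.lean` are change-of-variables moves);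
* `KZ.semiCanonicalReduction_of_boundedReduction` — Thm. 1.1 from step (b) in its weakest useful
  form (pieces with bounded domains and bounded integrands);
* `KZ.semiCanonicalReduction_of_separationOfPoles` — Thm. 1.1 from step (b) as printed
  (Cor. 2.2: rational pieces on compact domains).

## References

* J. Viu-Sos, *A semi-canonical reduction for periods of Kontsevich–Zagier*, Int. J. Number
  Theory 17 (2021) 147–174 (arXiv:1509.01097): Thm. 1.1; §2.2 Prop. 2.1, Thm. 2.1, Cor. 2.1;
  §2.3 Thm. 2.2, Prop. 2.2, Cor. 2.2, Cor. 2.3; §4 Lemmas 4.1, 4.2, 4.3 and §4.2.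
* M. Yoshinaga, *Periods and elementary real numbers*, arXiv:0805.0349 (2008), §3.4 (the Riemann
  sums used in step (d), as in `SemialgebraicVolume.lean`).
* M. Kontsevich, D. Zagier, *Periods* (2001), §1.2 (the rules).
-/

noncomputable section

open MeasureTheory Set MvPolynomial Filter Topology
open scoped ENNReal
open Literature.ModelTheory.ExponentialFields

namespace Literature.NumberTheory.Transcendental

namespace KZ

variable {n : ℕ}

/-! ### Generalities on relations: null modifications and finite almost-partitions -/

/-- Finite sums of relations, termwise: if `cᵢ − dᵢ ∈ relations` for `i ∈ s` then
`∑ cᵢ − ∑ dᵢ ∈ relations`. [folklore] -/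
theorem sum_sub_sum_mem_relations {ι : Type*} (s : Finset ι) (c d : ι → FormalRep)
    (h : ∀ i ∈ s, c i - d i ∈ relations) : ∑ i ∈ s, c i - ∑ i ∈ s, d i ∈ relations := by
  rw [← Finset.sum_sub_distrib]
  exact sum_mem h

/-- **Null modifications are relations.** Two representations of the same dimension whose domains
differ by Lebesgue-null sets and whose integrands agree on the common part of the domains differ by
a relation. [Kontsevich–Zagier 2001, §1.2, rule (1)] [cite: KontsevichZagier2001, §1.2 rule (1)] -/
theorem of_sub_of_mem_relations_of_null (r r' : IntegralRep n)
    (h₁ : volume (r.domain \ r'.domain) = 0) (h₂ : volume (r'.domain \ r.domain) = 0)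
    (hint : EqOn r.integrand r'.integrand (r.domain ∩ r'.domain)) : of r - of r' ∈ relations := by
  have hI : IsSemialgebraic ℚ (r.domain ∩ r'.domain) :=
    r.isSemialgebraic_domain.inter r'.isSemialgebraic_domain
  have hI' : IsSemialgebraic ℚ (r'.domain ∩ r.domain) :=
    r'.isSemialgebraic_domain.inter r.isSemialgebraic_domain
  have e1 : of r - of (r.restrict _ hI inter_subset_left) ∈ relations :=
    r.of_sub_of_restrict_mem_relations hI inter_subset_left (by rwa [sdiff_self_inter])
  have e2 : of r' - of (r'.restrict _ hI' inter_subset_left) ∈ relations :=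
    r'.of_sub_of_restrict_mem_relations hI' inter_subset_left (by rwa [sdiff_self_inter])
  have e3 : of (r.restrict _ hI inter_subset_left) - of (r'.restrict _ hI' inter_subset_left) ∈
      relations :=
    of_sub_of_mem_relations_of_eqOn (by simp [inter_comm]) (by simpa using hint)
  have : of r - of r' = (of r - of (r.restrict _ hI inter_subset_left)) +
      (of (r.restrict _ hI inter_subset_left) - of (r'.restrict _ hI' inter_subset_left)) -
      (of r' - of (r'.restrict _ hI' inter_subset_left)) := by abel
  rw [this]
  exact relations.sub_mem (relations.add_mem e1 e3) e2

/-- **Iterated domain additivity over a finite almost-partition.** If the domains of the `Rᵢ`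
(`i ∈ s`) lie in the domain of `r` up to null sets, pairwise meet in null sets, cover the domain
of `r` up to a null set, and carry the integrand of `r` on the overlaps, then
`[r] − ∑ᵢ [Rᵢ] ∈ relations`. [Kontsevich–Zagier 2001, §1.2, rule (1)]
[cite: KontsevichZagier2001, §1.2 rule (1)] -/
theorem of_sub_sum_of_mem_relations {ι : Type*} (s : Finset ι) :
    ∀ (r : IntegralRep n) (R : ι → IntegralRep n),
      (∀ i ∈ s, volume ((R i).domain \ r.domain) = 0) →
      (∀ i ∈ s, EqOn (R i).integrand r.integrand ((R i).domain ∩ r.domain)) →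
      volume (r.domain \ ⋃ i ∈ s, (R i).domain) = 0 →
      (s : Set ι).Pairwise (fun i j => volume ((R i).domain ∩ (R j).domain) = 0) →
      of r - ∑ i ∈ s, of (R i) ∈ relations := by
  classical
  induction s using Finset.induction_on with
  | empty =>
    intro r R _ _ hcov _
    simp only [Finset.notMem_empty, iUnion_of_empty, iUnion_empty, sdiff_empty] at hcov
    simpa using of_mem_relations_of_volume_eq_zero r hcov
  | insert a s ha ih =>
    intro r R hdom hint hcov hdisj
    -- split `r` along the domain of `R a`
    have hA : IsSemialgebraic ℚ (r.domain ∩ (R a).domain) :=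
      r.isSemialgebraic_domain.inter (R a).isSemialgebraic_domain
    have hB : IsSemialgebraic ℚ (r.domain \ (R a).domain) :=
      r.isSemialgebraic_domain.diff (R a).isSemialgebraic_domain
    set r₁ := r.restrict _ hA inter_subset_left with hr₁
    set r₂ := r.restrict _ hB sdiff_subset with hr₂
    have hsplit : of r - of r₁ - of r₂ ∈ relations :=
      domainAddRel_subset_relations ⟨n, r, r₁, r₂, by simp [hr₁, hr₂],
        by rw [show r₁.domain ∩ r₂.domain = ∅ from
          eq_empty_of_forall_notMem fun x hx => hx.2.2 hx.1.2, measure_empty],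
        fun _ _ => rfl, fun _ _ => rfl, rfl⟩
    -- `[r₁] ≡ [R a]`
    have h₁ : of r₁ - of (R a) ∈ relations := by
      refine of_sub_of_mem_relations_of_null r₁ (R a) ?_ ?_ ?_
      · simp [hr₁, sdiff_eq_empty.mpr inter_subset_right]
      · have : (R a).domain \ r₁.domain = (R a).domain \ r.domain := by
          simp [hr₁]
        rw [this]
        exact hdom a (Finset.mem_insert_self a s)
      · intro x hx
        exact (hint a (Finset.mem_insert_self a s) ⟨hx.2, hx.1.1⟩).symm
    -- the induction hypothesis for `r₂`
    have h₂ : of r₂ - ∑ i ∈ s, of (R i) ∈ relations := by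
      refine ih r₂ R (fun i hi => ?_) (fun i hi => ?_) ?_ ?_
      · have hsub : (R i).domain \ r₂.domain ⊆ ((R i).domain \ r.domain) ∪
            ((R i).domain ∩ (R a).domain) := by
          intro x hx
          by_cases hxr : x ∈ r.domain
          · exact Or.inr ⟨hx.1, by_contra fun h => hx.2 ⟨hxr, h⟩⟩
          · exact Or.inl ⟨hx.1, hxr⟩
        refine measure_mono_null hsub (measure_union_null (hdom i (Finset.mem_insert_of_mem hi))
          (hdisj (Finset.mem_insert_of_mem hi) (Finset.mem_insert_self a s)
            (fun h => ha (h ▸ hi))))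
      · exact fun x hx => hint i (Finset.mem_insert_of_mem hi) ⟨hx.1, hx.2.1⟩
      · have : r₂.domain \ ⋃ i ∈ s, (R i).domain =
            r.domain \ ⋃ i ∈ insert a s, (R i).domain := by
          rw [Finset.set_biUnion_insert, hr₂, IntegralRep.domain_restrict, sdiff_sdiff_left]
          rfl
        rw [this]
        exact hcov
      · exact hdisj.mono (Finset.coe_subset.mpr (Finset.subset_insert a s))
    rw [Finset.sum_insert ha]
    have : of r - (of (R a) + ∑ i ∈ s, of (R i)) =
        (of r - of r₁ - of r₂) + (of r₁ - of (R a)) + (of r₂ - ∑ i ∈ s, of (R i)) := by abel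
    rw [this]
    exact relations.add_mem (relations.add_mem hsplit h₁) h₂


/-! ### Representations with integrand `1`, and their closures -/

/-- A representation whose integrand is `1` on its domain represents the volume of the domain.
[folklore] -/
theorem IntegralRep.value_eq_volume_real (r : IntegralRep n) (h : ∀ x ∈ r.domain, r.integrand x = 1) :
    r.value = volume.real r.domain := by
  rw [IntegralRep.value, setIntegral_congr_fun (IntegralRep.measurableSet_domain_holds r) h,
    setIntegral_const, smul_eq_mul, mul_one]

/-- The representation `∫_σ 1` on a `ℚ`-semialgebraic set of finite volume.
[Kontsevich–Zagier 2001, §1.1] [cite: KontsevichZagier2001, §1.1] -/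
theorem exists_oneRep {σ : Set (Fin n → ℝ)} (hσ : IsSemialgebraic ℚ σ) (hfin : volume σ ≠ ⊤) :
    ∃ r : IntegralRep n, r.domain = σ ∧ r.integrand = fun _ => 1 :=
  ⟨⟨σ, fun _ => 1, hσ, by simpa using isSemialgebraicFunOn_ratCast hσ 1,
    integrableOn_const hfin⟩, rfl, rfl⟩

/-- **Passing to the closure.** A representation with integrand `1` on a bounded domain `D` differs
by a relation from `∫_{closure D} 1` (the frontier of a semialgebraic set is null), and the latter
domain is compact, with non-empty interior as soon as `vol D > 0`.
[Viu-Sos 2021, §4.2 ("we define `K` as the closure …")] [cite: ViuSos2021, §4.2] -/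
theorem exists_closure_of_integrand_one (r : IntegralRep n) (h : ∀ x ∈ r.domain, r.integrand x = 1)
    (hb : Bornology.IsBounded r.domain) :
    ∃ K : IntegralRep n, K.domain = closure r.domain ∧ (K.integrand = fun _ => 1) ∧
      IsCompact K.domain ∧ (0 < volume r.domain → (interior K.domain).Nonempty) ∧
      of r - of K ∈ relations := by
  have hcl : IsSemialgebraic ℚ (closure r.domain) := isSemialgebraic_closure r.isSemialgebraic_domain
  have hcpt : IsCompact (closure r.domain) := hb.isCompact_closure
  obtain ⟨K, hKd, hKi⟩ := exists_oneRep hcl hcpt.measure_lt_top.ne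
  refine ⟨K, hKd, hKi, hKd ▸ hcpt, fun hpos => ?_, ?_⟩
  · by_contra hne
    rw [not_nonempty_iff_eq_empty] at hne
    have h0 : volume K.domain = 0 := volume_eq_zero_of_interior_eq_empty K.isSemialgebraic_domain hne
    rw [hKd] at h0
    exact hpos.ne' (measure_mono_null subset_closure h0)
  · refine of_sub_of_mem_relations_of_null r K ?_ ?_ fun x hx => ?_
    · rw [hKd, sdiff_eq_empty.mpr subset_closure]
      exact measure_empty
    · rw [hKd]
      refine measure_mono_null (fun x hx => ?_)
        (volume_frontier_eq_zero_of_isSemialgebraic r.isSemialgebraic_domain)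
      exact ⟨hx.1, fun hx' => hx.2 (interior_subset hx')⟩
    · rw [h x hx.1, hKi]

/-! ### Translations are change-of-variables moves -/

/-- The translate of a set by `w`, as a preimage and as an image. [folklore] -/
theorem preimage_sub_eq_image_add (w : Fin n → ℝ) (s : Set (Fin n → ℝ)) :
    (fun x => x - w) ⁻¹' s = (fun x => x + w) '' s := by
  ext x
  simp only [mem_preimage, mem_image]
  exact ⟨fun h => ⟨x - w, h, sub_add_cancel x w⟩, fun ⟨y, hy, hyx⟩ => by
    rwa [← hyx, add_sub_cancel_right]⟩

/-- **Translation by a rational vector is a change-of-variables move** (rule (2) along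
`Φ x = x + v`, a polynomial map with identity derivative and Jacobian `1`): `[σ, f]` differs by a
move from `[σ + v, f (· − v)]`. [Kontsevich–Zagier 2001, §1.2, rule (2); Viu-Sos 2021, Cor. 2.3
("a sequence of `ℝ̃`-translations"), Lemma 4.3] [cite: ViuSos2021, Lemma 4.3] -/
theorem exists_translate (r : IntegralRep n) (v : Fin n → ℚ) :
    ∃ r' : IntegralRep n, r'.domain = (fun x => x - fun i => (v i : ℝ)) ⁻¹' r.domain ∧
      (r'.integrand = fun x => r.integrand (x - fun i => (v i : ℝ))) ∧
      of r - of r' ∈ changeOfVariablesRel := by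
  set w : Fin n → ℝ := fun i => (v i : ℝ) with hw
  -- the translate is a representation
  have hpoly : ∀ x : Fin n → ℝ,
      (fun j => aeval x (X j - C (v j) : MvPolynomial (Fin n) ℚ)) = x - w := fun x => by
    ext j
    simp [hw]
  have hdom : IsSemialgebraic ℚ ((fun x => x - w) ⁻¹' r.domain) := by
    have := r.isSemialgebraic_domain.preimage_aeval
      (fun j : Fin n => (X j - C (v j) : MvPolynomial (Fin n) ℚ))
    have heq : (fun (x : Fin n → ℝ) (j : Fin n) => aeval x (X j - C (v j) : MvPolynomial (Fin n) ℚ)) =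
        fun x => x - w := funext hpoly
    rwa [heq] at this
  have hmap : IsSemialgebraicMapOn ℚ ((fun x => x - w) ⁻¹' r.domain) (fun x => x - w) :=
    (isSemialgebraicMapOn_aeval hdom fun j => (X j - C (v j) : MvPolynomial (Fin n) ℚ)).congr
      fun x _ => hpoly x
  have hfun : IsSemialgebraicFunOn ℚ ((fun x => x - w) ⁻¹' r.domain)
      (fun x => r.integrand (x - w)) :=
    IsSemialgebraicFunOn.comp_isSemialgebraicMapOn_holds r.isSemialgebraicFunOn_integrand hmap
      fun _ hx => hx
  have hint : IntegrableOn (fun x => r.integrand (x - w)) ((fun x => x - w) ⁻¹' r.domain) :=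
    ((measurePreserving_sub_right volume w).integrableOn_comp_preimage
      (MeasurableEquiv.subRight w).measurableEmbedding).mpr r.integrableOn
  let r' : IntegralRep n := ⟨_, _, hdom, hfun, hint⟩
  refine ⟨r', rfl, rfl, ?_⟩
  -- the move, along `Φ x = x + w`
  have hpoly' : ∀ x : Fin n → ℝ,
      (fun j => aeval x (X j + C (v j) : MvPolynomial (Fin n) ℚ)) = x + w := fun x => by
    ext j
    simp [hw]
  refine ⟨n, r, r', fun x => x + w, fun _ => ContinuousLinearMap.id ℝ _, ?_, ?_, ?_, ?_, ?_, rfl⟩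
  · exact (isSemialgebraicMapOn_aeval r.isSemialgebraic_domain
      fun j => (X j + C (v j) : MvPolynomial (Fin n) ℚ)).congr fun x _ => hpoly' x
  · exact fun x _ => ((hasFDerivAt_id x).add_const w).hasFDerivWithinAt
  · exact fun x _ y _ h => add_right_cancel h
  · exact preimage_sub_eq_image_add w r.domain
  · intro x _
    have hdet : (ContinuousLinearMap.id ℝ (Fin n → ℝ)).det = 1 := by
      rw [ContinuousLinearMap.det, ContinuousLinearMap.coe_id, LinearMap.det_id]
    simp [r', hdet]


/-! ### Step (d): the difference of two compact volumes is one compact volume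
[Viu-Sos 2021, §4] -/

section Cubes

variable {m : ℕ}

/-- Half-open dyadic cubes are `ℚ`-semialgebraic (linear inequalities with dyadic constants).
[folklore] -/
theorem isSemialgebraic_hoCube (j : ℕ) (k : Fin m → ℕ) : IsSemialgebraic ℚ (hoCube j k) := by
  have h : hoCube j k = ⋂ i ∈ (Finset.univ : Finset (Fin m)),
      ({x : Fin m → ℝ | aeval x (C ((k i : ℚ) / 2 ^ j) : MvPolynomial (Fin m) ℚ) ≤
          aeval x (X i : MvPolynomial (Fin m) ℚ)} ∩
        {x : Fin m → ℝ | aeval x (X i : MvPolynomial (Fin m) ℚ) <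
          aeval x (C (((k i : ℚ) + 1) / 2 ^ j) : MvPolynomial (Fin m) ℚ)}) := by
    ext x
    simp only [hoCube, cubeLo, cubeHi, mem_univ_pi, mem_Ico, Finset.mem_univ, iInter_true,
      mem_iInter, mem_inter_iff, mem_setOf_eq, aeval_C, aeval_X, eq_ratCast]
    push_cast
    rfl
  rw [h]
  exact IsSemialgebraic.biInter _ _ fun i _ =>
    (isSemialgebraic_setOf_eval_le _ _).inter (isSemialgebraic_setOf_eval_lt _ _)

/-- Translating the half-open cube of index `k` by `cubeLo k' − cubeLo k` gives the half-open cube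
of index `k'` (read on preimages). [Viu-Sos 2021, Lemma 4.3] [cite: ViuSos2021, Lemma 4.3] -/
theorem sub_mem_hoCube_iff {j : ℕ} {k k' : Fin m → ℕ} {x : Fin m → ℝ} :
    x - (cubeLo j k' - cubeLo j k) ∈ hoCube j k ↔ x ∈ hoCube j k' := by
  simp only [hoCube, mem_univ_pi, mem_Ico, Pi.sub_apply, cubeLo, cubeHi]
  refine forall_congr' fun i => ?_
  constructor <;> rintro ⟨h1, h2⟩ <;> constructor <;>
    first | linarith | (rw [add_div] at *; linarith)

/-- The rational vector `(k' − k) / 2ʲ` realises `cubeLo k' − cubeLo k`. [folklore] -/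
theorem ratCast_cubeShift (j : ℕ) (k k' : Fin m → ℕ) :
    (fun i => (((fun i => ((k' i : ℚ) - k i) / 2 ^ j) i : ℚ) : ℝ)) = cubeLo j k' - cubeLo j k := by
  ext i
  simp only [Pi.sub_apply, cubeLo]
  push_cast
  ring

/-- A point of a set in the box `[0, L/2ʲ)ᵐ` lies in a half-open cube whose code is an outer index.
[cite: Yoshinaga2008, §3.4] -/
theorem exists_mem_outerIdx_mem_hoCube {s : Set (Fin m → ℝ)} {j L : ℕ} {x : Fin m → ℝ} (hx : x ∈ s)
    (hbox : ∀ i, 0 ≤ x i ∧ x i * 2 ^ j < L) :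
    ∃ K ∈ outerIdx s j L, x ∈ hoCube j (digits m L K) := by
  classical
  set k : Fin m → ℕ := fun i => ⌊x i * 2 ^ j⌋₊ with hk
  have hxk : x ∈ hoCube j k := mem_hoCube_floor fun i => (hbox i).1
  have hklt : ∀ i, k i < L := fun i =>
    (Nat.floor_lt (mul_nonneg (hbox i).1 (by positivity))).2 (hbox i).2
  obtain ⟨K, hKlt, hKk⟩ := exists_digits_eq k hklt
  refine ⟨K, ?_, by rw [hKk]; exact hxk⟩
  simp only [outerIdx, Finset.mem_filter, Finset.mem_range]
  exact ⟨hKlt, ⟨x, by rw [hKk]; exact hoCube_subset_closedCube j k hxk, hx⟩⟩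

/-- Inner indices index closed cubes contained in the set. [cite: Yoshinaga2008, §3.4] -/
theorem closedCube_subset_of_mem_innerIdx {s : Set (Fin m → ℝ)} {j L K : ℕ}
    (hK : K ∈ innerIdx s j L) : closedCube j (digits m L K) ⊆ s := by
  classical
  simp only [innerIdx, Finset.mem_filter] at hK
  exact hK.2

/-- **Lemmas 4.1–4.2 of Viu-Sos (cube counts).** For bounded sets `s, t` with null frontiers,
`s` in the box `[0, L₀)ᵐ`, and `vol t < vol s`, at some dyadic level `j` the number of closed cubes
of the grid of mesh `2⁻ʲ` on `[0, L₀)ᵐ` that MEET `t` is at most the number of those CONTAINED in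
`s`: the outer count of `t` and the inner count of `s`, times the cube volume, tend to `vol t` and
`vol s` (`SemialgebraicVolume.lean`). [Viu-Sos 2021, Lemma 4.1, Lemma 4.2]
[cite: ViuSos2021, Lemma 4.2] -/
theorem exists_card_outerIdx_le_card_innerIdx {s t : Set (Fin m → ℝ)} (hs : Bornology.IsBounded s)
    (ht : Bornology.IsBounded t) (hfs : volume (frontier s) = 0) (hft : volume (frontier t) = 0)
    {L₀ : ℕ} (hbox : ∀ x ∈ s, ∀ i, 0 ≤ x i ∧ x i < L₀) (hlt : volume t < volume s) :
    ∃ j, (outerIdx t j (L₀ * 2 ^ j)).card ≤ (innerIdx s j (L₀ * 2 ^ j)).card := by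
  have hs_top : volume s ≠ ⊤ := hs.measure_lt_top.ne
  have ht_top : volume t ≠ ⊤ := ht.measure_lt_top.ne
  set δ := volume s - volume t with hδ
  have hδ0 : δ ≠ 0 := (tsub_pos_iff_lt.mpr hlt).ne'
  set ε := δ / 2 / 2 with hε
  have hε0 : 0 < ε := ENNReal.div_pos_iff.mpr ⟨(ENNReal.div_pos_iff.mpr ⟨hδ0, by norm_num⟩).ne',
    by norm_num⟩
  have hεε : ε + ε < δ := by
    rw [hε, ENNReal.add_halves]
    exact ENNReal.half_lt_self hδ0 (ne_top_of_le_ne_top hs_top tsub_le_self)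
  obtain ⟨j, hjs, hjt⟩ := (((tendsto_volume_cthickening_frontier hs hfs).eventually
    (ge_mem_nhds hε0)).and ((tendsto_volume_cthickening_frontier ht hft).eventually
    (ge_mem_nhds hε0))).exists
  refine ⟨j, ?_⟩
  set L := L₀ * 2 ^ j with hL
  set h : ℝ≥0∞ := ENNReal.ofReal ((1 / 2 ^ j) ^ m) with hh
  -- the four Riemann-sum inequalities
  have gap_s := (card_sub_card_mul_le s j L).trans hjs
  have gap_t := (card_sub_card_mul_le t j L).trans hjt
  have out_s : volume s ≤ ((outerIdx s j L).card : ℝ≥0∞) * h :=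
    le_card_outerIdx_mul s j L fun x hx i => ⟨(hbox x hx i).1, by
      rw [hL, Nat.cast_mul, Nat.cast_pow, Nat.cast_ofNat]
      exact mul_lt_mul_of_pos_right (hbox x hx i).2 (by positivity)⟩
  have in_t : ((innerIdx t j L).card : ℝ≥0∞) * h ≤ volume t := card_innerIdx_mul_le t j L
  have split : ∀ u : Set (Fin m → ℝ), ((outerIdx u j L).card : ℝ≥0∞) * h =
      ((innerIdx u j L).card : ℝ≥0∞) * h +
        (((outerIdx u j L).card - (innerIdx u j L).card : ℕ) : ℝ≥0∞) * h := fun u => by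
    rw [← add_mul, ← Nat.cast_add, Nat.add_sub_cancel' (Finset.card_le_card
      (innerIdx_subset_outerIdx u j L))]
  by_contra hlt'
  rw [not_le] at hlt'
  have h1 : volume s ≤ ((innerIdx s j L).card : ℝ≥0∞) * h + ε :=
    out_s.trans (by rw [split s]; exact add_le_add le_rfl gap_s)
  have h2 : ((innerIdx s j L).card : ℝ≥0∞) * h ≤ ((outerIdx t j L).card : ℝ≥0∞) * h :=
    mul_le_mul' (by exact_mod_cast hlt'.le) le_rfl
  have h3 : ((outerIdx t j L).card : ℝ≥0∞) * h ≤ volume t + ε := by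
    rw [split t]
    exact add_le_add in_t gap_t
  have h4 : volume s ≤ volume t + (ε + ε) :=
    calc volume s ≤ ((outerIdx t j L).card : ℝ≥0∞) * h + ε := h1.trans (add_le_add h2 le_rfl)
      _ ≤ volume t + ε + ε := add_le_add h3 le_rfl
      _ = volume t + (ε + ε) := add_assoc _ _ _
  have h5 : volume t + (ε + ε) < volume t + δ := ENNReal.add_lt_add_left ht_top hεε
  rw [hδ, add_tsub_cancel_of_le hlt.le] at h5
  exact lt_irrefl _ (h4.trans_lt h5)


/-- **Step (d) in a box** [Viu-Sos 2021, §4.2, with Lemma 4.3]. Let `K₁`, `K₂` be representations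
with bounded domains in the box `[0, L₀)ᵐ`, integrand `1`, and `vol K₂ < vol K₁` (Viu-Sos: compact
domains; only boundedness and the null frontier of semialgebraic sets are used). At the level `j`
of `exists_card_outerIdx_le_card_innerIdx` choose an injection `ψ` of the cubes meeting `K₂` into
the cubes inside `K₁`; split `K₂` along the half-open cubes (rule (1); the cubes tile the box),
translate each piece by `cubeLo (ψ K) − cubeLo K` (rule (2), `exists_translate`) into `K₁`, split
`K₁` into the translated pieces and the rest `D` (rule (1)); then `[K₁] − [K₂] ≡ [D, 1]`,
`vol D = vol K₁ − vol K₂ > 0` by soundness of the moves, and `K = closure D` (null frontier) is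
compact with non-empty interior. [cite: ViuSos2021, §4.2 and Lemma 4.3] -/
theorem exists_isCompact_of_sub_of_sub_mem_relations_of_box (K₁ K₂ : IntegralRep m)
    (h₁c : Bornology.IsBounded K₁.domain) (h₂c : Bornology.IsBounded K₂.domain)
    (h₁i : ∀ x ∈ K₁.domain, K₁.integrand x = 1) (h₂i : ∀ x ∈ K₂.domain, K₂.integrand x = 1)
    {L₀ : ℕ} (hb₁ : ∀ x ∈ K₁.domain, ∀ i, 0 ≤ x i ∧ x i < L₀)
    (hb₂ : ∀ x ∈ K₂.domain, ∀ i, 0 ≤ x i ∧ x i < L₀) (hlt : K₂.value < K₁.value) :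
    ∃ K : IntegralRep m, IsCompact K.domain ∧ (interior K.domain).Nonempty ∧
      (∀ x ∈ K.domain, K.integrand x = 1) ∧ of K₁ - of K₂ - of K ∈ relations := by
  classical
  -- volumes
  have hV₁ : K₁.value = volume.real K₁.domain := K₁.value_eq_volume_real h₁i
  have hV₂ : K₂.value = volume.real K₂.domain := K₂.value_eq_volume_real h₂i
  have h₁top : volume K₁.domain ≠ ⊤ := h₁c.measure_lt_top.ne
  have h₂top : volume K₂.domain ≠ ⊤ := h₂c.measure_lt_top.ne
  have hvol : volume K₂.domain < volume K₁.domain := by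
    rw [hV₁, hV₂, measureReal_def, measureReal_def] at hlt
    exact (ENNReal.toReal_lt_toReal h₂top h₁top).mp hlt
  -- the level and the injection of cubes
  obtain ⟨j, hcard⟩ := exists_card_outerIdx_le_card_innerIdx h₁c h₂c
    (volume_frontier_eq_zero_of_isSemialgebraic K₁.isSemialgebraic_domain)
    (volume_frontier_eq_zero_of_isSemialgebraic K₂.isSemialgebraic_domain) hb₁ hvol
  set L := L₀ * 2 ^ j with hL
  set out₂ := outerIdx K₂.domain j L with hout₂
  set in₁ := innerIdx K₁.domain j L with hin₁
  have hcard' : Fintype.card out₂ ≤ Fintype.card in₁ := by simpa using hcard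
  obtain ⟨e⟩ := Function.Embedding.nonempty_of_card_le hcard'
  let ψ : ℕ → ℕ := fun K => if hK : K ∈ out₂ then (e ⟨K, hK⟩ : ℕ) else 0
  have hψ_mem : ∀ {K}, K ∈ out₂ → ψ K ∈ in₁ := fun {K} hK => by
    simp only [ψ, hK, dite_true]
    exact (e ⟨K, hK⟩).2
  have hψ_inj : ∀ {K K'}, K ∈ out₂ → K' ∈ out₂ → ψ K = ψ K' → K = K' := by
    intro K K' hK hK' h
    simp only [ψ, hK, hK', dite_true] at h
    have := e.injective (Subtype.ext h)
    simpa using this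
  have hin₁_lt : (↑in₁ : Set ℕ) ⊆ {K | K < L ^ m} :=
    (Finset.coe_subset.2 (innerIdx_subset_outerIdx _ j L)).trans (coe_outerIdx_subset _ j L)
  -- cube indices, pieces of `K₂`, translation vectors
  let k : ℕ → Fin m → ℕ := fun K => digits m L K
  let k' : ℕ → Fin m → ℕ := fun K => digits m L (ψ K)
  have hP : ∀ K, IsSemialgebraic ℚ (K₂.domain ∩ hoCube j (k K)) := fun K =>
    K₂.isSemialgebraic_domain.inter (isSemialgebraic_hoCube j (k K))
  let R₂ : ℕ → IntegralRep m := fun K => K₂.restrict _ (hP K) inter_subset_left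
  let v : ℕ → Fin m → ℚ := fun K i => ((k' K i : ℚ) - k K i) / 2 ^ j
  have hv : ∀ K, (fun i => (v K i : ℝ)) = cubeLo j (k' K) - cubeLo j (k K) := fun K =>
    ratCast_cubeShift j (k K) (k' K)
  choose Q hQd hQi hQrel using fun K => exists_translate (R₂ K) (v K)
  -- [K₂] ≡ ∑ [R₂ K]
  have e5 : of K₂ - ∑ K ∈ out₂, of (R₂ K) ∈ relations := by
    refine of_sub_sum_of_mem_relations out₂ K₂ R₂ (fun K _ => ?_) (fun K _ _ _ => rfl) ?_ ?_
    · rw [show (R₂ K).domain \ K₂.domain = ∅ from sdiff_eq_empty.mpr inter_subset_left,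
        measure_empty]
    · rw [sdiff_eq_empty.mpr, measure_empty]
      intro x hx
      have hbox : ∀ i, 0 ≤ x i ∧ x i * 2 ^ j < L := fun i => ⟨(hb₂ x hx i).1, by
        rw [hL, Nat.cast_mul, Nat.cast_pow, Nat.cast_ofNat]
        exact mul_lt_mul_of_pos_right (hb₂ x hx i).2 (by positivity)⟩
      obtain ⟨K, hK, hxK⟩ := exists_mem_outerIdx_mem_hoCube hx hbox
      exact mem_biUnion hK ⟨hx, hxK⟩
    · intro K hK K' hK' hne
      have hd := pairwiseDisjoint_hoCube_digits j L (coe_outerIdx_subset K₂.domain j L) hK hK' hne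
      rw [show (R₂ K).domain ∩ (R₂ K').domain = ∅ from ?_, measure_empty]
      exact Set.disjoint_iff_inter_eq_empty.mp (hd.mono inter_subset_right inter_subset_right)
  -- ∑ [R₂ K] ≡ ∑ [Q K]
  have e6 : ∑ K ∈ out₂, of (R₂ K) - ∑ K ∈ out₂, of (Q K) ∈ relations :=
    sum_sub_sum_mem_relations out₂ _ _ fun K _ => changeOfVariablesRel_subset_relations (hQrel K)
  -- the translated pieces lie in the inner cubes of `K₁`
  have hQsub : ∀ {K}, K ∈ out₂ → (Q K).domain ⊆ hoCube j (k' K) := fun {K} hK x hx => by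
    rw [hQd, hv] at hx
    exact sub_mem_hoCube_iff.mp hx.2
  have hQK₁ : ∀ {K}, K ∈ out₂ → (Q K).domain ⊆ K₁.domain := fun {K} hK =>
    (hQsub hK).trans ((hoCube_subset_closedCube j _).trans
      (closedCube_subset_of_mem_innerIdx (hψ_mem hK)))
  have hQone : ∀ {K}, K ∈ out₂ → ∀ x ∈ (Q K).domain, (Q K).integrand x = 1 := fun {K} _ x hx => by
    rw [hQi]
    rw [hQd] at hx
    exact h₂i _ hx.1
  set U := ⋃ K ∈ out₂, (Q K).domain with hU
  have hUs : IsSemialgebraic ℚ U := IsSemialgebraic.biUnion _ _ fun K _ => (Q K).isSemialgebraic_domain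
  have hUK₁ : U ⊆ K₁.domain := iUnion₂_subset fun K hK => hQK₁ hK
  have hDs : IsSemialgebraic ℚ (K₁.domain \ U) := K₁.isSemialgebraic_domain.diff hUs
  set KU := K₁.restrict U hUs hUK₁ with hKU
  set KD := K₁.restrict (K₁.domain \ U) hDs sdiff_subset with hKD
  -- [K₁] ≡ [K₁|U] + [K₁|D]
  have e8 : of K₁ - of KU - of KD ∈ relations :=
    domainAddRel_subset_relations ⟨m, K₁, KU, KD, by simp [hKU, hKD, union_sdiff_cancel hUK₁],
      by rw [show KU.domain ∩ KD.domain = ∅ from eq_empty_of_forall_notMem fun x hx => hx.2.2 hx.1,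
        measure_empty], fun _ _ => rfl, fun _ _ => rfl, rfl⟩
  -- [K₁|U] ≡ ∑ [Q K]
  have e7 : of KU - ∑ K ∈ out₂, of (Q K) ∈ relations := by
    refine of_sub_sum_of_mem_relations out₂ KU Q (fun K hK => ?_) (fun K hK x hx => ?_) ?_ ?_
    · rw [hKU, IntegralRep.domain_restrict, sdiff_eq_empty.mpr, measure_empty]
      exact subset_iUnion₂_of_subset K hK Subset.rfl
    · rw [hQone hK x hx.1]
      exact (h₁i x (hUK₁ hx.2)).symm
    · rw [hKU, IntegralRep.domain_restrict, Set.sdiff_self, measure_empty]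
    · intro K hK K' hK' hne
      have hne' : ψ K ≠ ψ K' := fun h => hne (hψ_inj hK hK' h)
      have hd := pairwiseDisjoint_hoCube_digits j L hin₁_lt (hψ_mem hK) (hψ_mem hK') hne'
      rw [show (Q K).domain ∩ (Q K').domain = ∅ from
        Set.disjoint_iff_inter_eq_empty.mp (hd.mono (hQsub hK) (hQsub hK')), measure_empty]
  -- hence [K₁] − [K₂] ≡ [K₁|D]
  have e9 : of K₁ - of K₂ - of KD ∈ relations := by
    have : of K₁ - of K₂ - of KD = (of K₁ - of KU - of KD) + (of KU - ∑ K ∈ out₂, of (Q K)) -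
        (∑ K ∈ out₂, of (R₂ K) - ∑ K ∈ out₂, of (Q K)) - (of K₂ - ∑ K ∈ out₂, of (R₂ K)) := by
      abel
    rw [this]
    exact relations.sub_mem (relations.sub_mem (relations.add_mem e8 e7) e6) e5
  -- the volume of `D` by soundness
  have hDone : ∀ x ∈ KD.domain, KD.integrand x = 1 := fun x hx => h₁i x hx.1
  have hDvol : 0 < volume KD.domain := by
    have h0 := relations_le_ker_eval_holds e9
    rw [AddMonoidHom.mem_ker, map_sub, map_sub, eval_of, eval_of, eval_of,
      KD.value_eq_volume_real hDone] at h0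
    have hpos : 0 < volume.real KD.domain := by linarith
    rw [measureReal_def] at hpos
    exact (ENNReal.toReal_pos_iff.mp hpos).1
  -- pass to the closure
  obtain ⟨K, -, hKi, hKc, hKint, hKrel⟩ := exists_closure_of_integrand_one KD hDone
    (h₁c.subset sdiff_subset)
  refine ⟨K, hKc, hKint hDvol, fun x _ => by rw [hKi], ?_⟩
  have : of K₁ - of K₂ - of K = (of K₁ - of K₂ - of KD) + (of KD - of K) := by abel
  rw [this]
  exact relations.add_mem e9 hKrel


/-- Translating a representation with bounded domain and integrand `1` into the positive orthant:
by an integer vector, onto a representation with domain inside a box `[0, L₀)ᵐ`, integrand `1`,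
same value, differing by a move. [Viu-Sos 2021, §4.1 ("suppose … both of them are contained
in the cube `[0, r]^d`")] [cite: ViuSos2021, §4.1] -/
theorem exists_translate_box (r : IntegralRep m)
    (hi : ∀ x ∈ r.domain, r.integrand x = 1) {C : ℝ} (hC : ∀ x ∈ r.domain, ‖x‖ ≤ C) :
    ∃ r' : IntegralRep m, Bornology.IsBounded r'.domain ∧ (∀ x ∈ r'.domain, r'.integrand x = 1) ∧
      (∀ x ∈ r'.domain, ∀ i, 0 ≤ x i ∧ x i < (2 * (⌈C⌉₊ + 1) : ℕ)) ∧ r'.value = r.value ∧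
      of r - of r' ∈ relations := by
  set R₀ : ℕ := ⌈C⌉₊ + 1 with hR₀
  obtain ⟨r', hd, hint, hrel⟩ := exists_translate r fun _ => (R₀ : ℚ)
  have hrel' : of r - of r' ∈ relations := changeOfVariablesRel_subset_relations hrel
  have hw : (fun _ : Fin m => ((R₀ : ℚ) : ℝ)) = fun _ => (R₀ : ℝ) := funext fun _ => by push_cast; rfl
  rw [hw] at hd hint
  have hbox : ∀ x ∈ r'.domain, ∀ i, 0 ≤ x i ∧ x i < (2 * (⌈C⌉₊ + 1) : ℕ) := fun x hx i => by
    rw [hd] at hx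
    have h1 : |x i - R₀| ≤ C := by
      have := (norm_le_pi_norm (x - fun _ => (R₀ : ℝ)) i).trans (hC _ hx)
      simpa [Real.norm_eq_abs] using this
    have hCR : C < R₀ := by
      rw [hR₀, Nat.cast_add, Nat.cast_one]
      exact (Nat.le_ceil C).trans_lt (lt_add_one _)
    have hR₀' : (R₀ : ℝ) = ⌈C⌉₊ + 1 := by rw [hR₀]; push_cast; rfl
    rw [abs_le] at h1
    constructor
    · linarith
    · push_cast
      linarith
  refine ⟨r', ?_, fun x hx => ?_, hbox, (Equivalent.value_eq_holds hrel').symm, hrel'⟩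
  · refine isBounded_iff_forall_norm_le.mpr ⟨(2 * (⌈C⌉₊ + 1) : ℕ), fun x hx => ?_⟩
    refine (pi_norm_le_iff_of_nonneg (Nat.cast_nonneg _)).mpr fun i => ?_
    rw [Real.norm_eq_abs, abs_le]
    constructor <;> linarith [(hbox x hx i).1, (hbox x hx i).2]
  · rw [hint]
    rw [hd] at hx
    exact hi _ hx

/-- **Step (d): the difference of two compact volumes is one compact volume** [Viu-Sos 2021, §4,
the last step of the proof of Thm. 1.1]. If `K₁`, `K₂` have bounded (Viu-Sos: compact) domains and
integrand `1` and `vol K₂ < vol K₁`, there is a representation `K` with compact domain of non-empty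
interior and integrand `1` such that `[K₁] − [K₂] − [K] ∈ relations` (translate both into a box by
integer vectors, rule (2), and apply `exists_isCompact_of_sub_of_sub_mem_relations_of_box`).
[cite: ViuSos2021, §4 (Lemmas 4.1–4.3 and §4.2)] -/
theorem exists_isCompact_of_sub_of_sub_mem_relations (K₁ K₂ : IntegralRep m)
    (h₁c : Bornology.IsBounded K₁.domain) (h₂c : Bornology.IsBounded K₂.domain)
    (h₁i : ∀ x ∈ K₁.domain, K₁.integrand x = 1) (h₂i : ∀ x ∈ K₂.domain, K₂.integrand x = 1)
    (hlt : K₂.value < K₁.value) :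
    ∃ K : IntegralRep m, IsCompact K.domain ∧ (interior K.domain).Nonempty ∧
      (∀ x ∈ K.domain, K.integrand x = 1) ∧ of K₁ - of K₂ - of K ∈ relations := by
  obtain ⟨C, hC⟩ := isBounded_iff_forall_norm_le.mp (h₁c.union h₂c)
  obtain ⟨K₁', h₁c', h₁i', hb₁, hv₁, e₁⟩ :=
    exists_translate_box K₁ h₁i fun x hx => hC x (Or.inl hx)
  obtain ⟨K₂', h₂c', h₂i', hb₂, hv₂, e₂⟩ :=
    exists_translate_box K₂ h₂i fun x hx => hC x (Or.inr hx)
  obtain ⟨K, hKc, hKint, hKi, hK⟩ := exists_isCompact_of_sub_of_sub_mem_relations_of_box K₁' K₂'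
    h₁c' h₂c' h₁i' h₂i' hb₁ hb₂ (by rwa [hv₁, hv₂])
  refine ⟨K, hKc, hKint, hKi, ?_⟩
  have : of K₁ - of K₂ - of K = (of K₁' - of K₂' - of K) + (of K₁ - of K₁') - (of K₂ - of K₂') := by
    abel
  rw [this]
  exact relations.sub_mem (relations.add_mem hK e₁) e₂


end Cubes

/-! ### Step (c): the region under the graph [Viu-Sos 2021, Cor. 2.3] -/

/-- **The region under the graph of a non-negative integrand is one Newton–Leibniz move away**:
for `r = (τ, f)` with `f ≥ 0` on `τ`, the representation `G` with domain the band
`{(x, t) | x ∈ τ, 0 ≤ t ≤ f x}` and integrand `1` satisfies `[G] − [r] ∈ newtonLeibnizRel`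
(primitive `F (x, t) = t`, edges `0 ≤ f`). Absolute convergence of `G` is Tonelli:
`vol(band) = ∫_τ f`. [Viu-Sos 2021, Cor. 2.3 ("considering integrals by the volume of the region
delimited by `P/Q`"); Kontsevich–Zagier 2001, §1.1–1.2] [cite: ViuSos2021, Cor. 2.3] -/
theorem exists_underGraph (r : IntegralRep n) (h0 : ∀ x ∈ r.domain, 0 ≤ r.integrand x) :
    ∃ G : IntegralRep (n + 1), G.domain = KZlog.band r.domain (fun _ => 0) r.integrand ∧
      (G.integrand = fun _ => 1) ∧ of G - of r ∈ newtonLeibnizRel := by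
  have hzero : IsSemialgebraicFunOn ℚ r.domain (fun _ => (0 : ℝ)) := by
    simpa using isSemialgebraicFunOn_ratCast r.isSemialgebraic_domain 0
  have hB : IsSemialgebraic ℚ (KZlog.band r.domain (fun _ => 0) r.integrand) :=
    KZlog.isSemialgebraic_band hzero r.isSemialgebraicFunOn_integrand
  have hBm : MeasurableSet (KZlog.band r.domain (fun _ => 0) r.integrand) :=
    IsSemialgebraic.measurableSet_holds hB
  have hint : IntegrableOn (fun _ => (1 : ℝ)) (KZlog.band r.domain (fun _ => 0) r.integrand) := by
    refine KZlog.integrableOn_band_of_lintegral_fibre_le (IntegralRep.measurableSet_domain_holds r)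
      hBm (fun x t => KZlog.snoc_mem_band) aestronglyMeasurable_const (K := r.integrand)
      (fun x hx => ?_) r.integrableOn
    rw [setLIntegral_const, Real.volume_Icc, sub_zero, enorm_one, one_mul,
      Real.enorm_eq_ofReal (h0 x hx)]
  let G : IntegralRep (n + 1) := ⟨_, fun _ => 1, hB,
    by simpa using isSemialgebraicFunOn_ratCast hB 1, hint⟩
  refine ⟨G, rfl, rfl, n, G, r, fun _ => 0, r.integrand, fun z => z (Fin.last n),
    isSemialgebraicFunOn_apply hB (Fin.last n), hzero, r.isSemialgebraicFunOn_integrand, h0, rfl,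
    fun x _ => ?_, fun x _ t _ => ?_, fun x _ => by simp, rfl⟩
  · simp only [Fin.snoc_last]
    exact continuousOn_id
  · simp only [Fin.snoc_last, G]
    exact hasDerivAt_id t

/-- **Step (c) [Viu-Sos 2021, Cor. 2.3]: an integral of a bounded semialgebraic function over a
bounded domain is a difference of two bounded volumes, by the moves.** For `r = (T, g)` with `T`
bounded and `|g| ≤ M` on `T`, split `T = T₊ ⊔ T₋` by the sign of `g` (rule (1); both pieces are
`ℚ`-semialgebraic by Tarski–Seidenberg), flip the sign on `T₋` (`[T₋, g] + [T₋, −g]` is a relation)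
and take the regions under the graphs (`exists_underGraph`): `[r] ≡ [A, 1] − [B, 1]` with
`A, B ⊂ ℝⁿ⁺¹` bounded (Viu-Sos does this for `g = P/Q` without poles on a compact `T`, splitting by
the sign of `P Q`). [cite: ViuSos2021, Cor. 2.3] -/
theorem exists_sub_of_isBounded (r : IntegralRep n) (hb : Bornology.IsBounded r.domain) {M : ℝ}
    (hM : ∀ x ∈ r.domain, |r.integrand x| ≤ M) :
    ∃ A B : IntegralRep (n + 1), Bornology.IsBounded A.domain ∧ Bornology.IsBounded B.domain ∧
      (∀ z ∈ A.domain, A.integrand z = 1) ∧ (∀ z ∈ B.domain, B.integrand z = 1) ∧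
      of r - (of A - of B) ∈ relations := by
  -- the sign pieces
  have hTms : IsSemialgebraic ℚ {x | x ∈ r.domain ∧ r.integrand x < 0} := by
    simpa using r.isSemialgebraicFunOn_integrand.isSemialgebraic_sep_lt
      Literature.ModelTheory.ExponentialFields.tarski_seidenberg_real_holds 0 0
  have hTps : IsSemialgebraic ℚ (r.domain \ {x | x ∈ r.domain ∧ r.integrand x < 0}) :=
    r.isSemialgebraic_domain.diff hTms
  set r₁ := r.restrict _ hTps sdiff_subset with hr₁
  set r₂ := r.restrict _ hTms (fun x hx => hx.1) with hr₂
  -- [r] ≡ [r₁] + [r₂]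
  have e1 : of r - of r₁ - of r₂ ∈ relations := by
    refine domainAddRel_subset_relations ⟨n, r, r₁, r₂, ?_, ?_, fun _ _ => rfl, fun _ _ => rfl, rfl⟩
    · rw [hr₁, hr₂, IntegralRep.domain_restrict, IntegralRep.domain_restrict,
        sdiff_union_of_subset fun x hx => hx.1]
    · rw [hr₁, hr₂, IntegralRep.domain_restrict, IntegralRep.domain_restrict,
        show (r.domain \ {x | x ∈ r.domain ∧ r.integrand x < 0}) ∩
          {x | x ∈ r.domain ∧ r.integrand x < 0} = ∅ from
          Set.disjoint_iff_inter_eq_empty.mp disjoint_sdiff_left, measure_empty]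
  -- signs on the pieces
  have hpos : ∀ x ∈ r₁.domain, 0 ≤ r₁.integrand x := fun x hx => by
    rw [hr₁, IntegralRep.integrand_restrict]
    by_contra h
    exact hx.2 ⟨hx.1, lt_of_not_ge h⟩
  have hneg : ∀ x ∈ r₂.neg.domain, 0 ≤ r₂.neg.integrand x := fun x hx => by
    rw [IntegralRep.integrand_neg, Pi.neg_apply, hr₂, IntegralRep.integrand_restrict, neg_nonneg]
    exact le_of_lt hx.2
  obtain ⟨A, hAd, hAi, hA⟩ := exists_underGraph r₁ hpos
  obtain ⟨B, hBd, hBi, hB⟩ := exists_underGraph r₂.neg hneg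
  -- the bands are bounded
  obtain ⟨C, hC⟩ := isBounded_iff_forall_norm_le.mp hb
  have hbd : ∀ {τ : Set (Fin n → ℝ)} {g : (Fin n → ℝ) → ℝ}, τ ⊆ r.domain →
      (∀ x ∈ τ, g x ≤ |r.integrand x|) → Bornology.IsBounded (KZlog.band τ (fun _ => 0) g) := by
    intro τ g hτ hg
    refine isBounded_iff_forall_norm_le.mpr ⟨max C M, fun z hz => ?_⟩
    rw [KZlog.mem_band] at hz
    have hxC : ‖Fin.init z‖ ≤ C := hC _ (hτ hz.1)
    refine (pi_norm_le_iff_of_nonneg ((norm_nonneg _).trans (hxC.trans (le_max_left _ _)))).mpr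
      fun i => Fin.lastCases ?_ (fun k => ?_) i
    · rw [Real.norm_eq_abs, abs_le]
      have := (hg _ hz.1).trans (hM _ (hτ hz.1))
      constructor <;> linarith [hz.2.1, hz.2.2, le_max_right C M, (norm_nonneg _).trans hxC]
    · exact ((norm_le_pi_norm (Fin.init z) k).trans hxC).trans (le_max_left _ _)
  refine ⟨A, B, ?_, ?_, fun z _ => by rw [hAi], fun z _ => by rw [hBi], ?_⟩
  · rw [hAd]
    exact hbd sdiff_subset fun x _ => le_abs_self _
  · rw [hBd]
    exact hbd (fun x hx => hx.1) fun x _ => by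
      rw [IntegralRep.integrand_neg, Pi.neg_apply, hr₂, IntegralRep.integrand_restrict]
      exact neg_le_abs _
  have e2 : of r₂ + of r₂.neg ∈ relations := levelRel_le_relations (of_add_of_neg_mem_levelRel r₂)
  have : of r - (of A - of B) = (of r - of r₁ - of r₂) - (of A - of r₁) + (of r₂ + of r₂.neg) +
      (of B - of r₂.neg) := by abel
  rw [this]
  exact relations.add_mem (relations.add_mem (relations.sub_mem e1
    (newtonLeibnizRel_subset_relations hA)) e2) (newtonLeibnizRel_subset_relations hB)

/-! ### Merging finitely many bounded volumes into one (disjoint translates, rule (1)) -/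

/-- Two representations with bounded domains and integrand `1` in dimension `n + 1` merge into one:
translate the second along the first coordinate beyond the first (rule (2)) and glue by domain
additivity (rule (1)). [Viu-Sos 2021, Cor. 2.3 ("there exists a sequence of translations … such
that ⋂ Kᵢ = ∅; defining K₁ = ⋃ Kᵢ⁺ …")] [cite: ViuSos2021, Cor. 2.3] -/
theorem exists_merge₂ (A B : IntegralRep (n + 1)) (hA : Bornology.IsBounded A.domain)
    (hB : Bornology.IsBounded B.domain)
    (hAi : ∀ z ∈ A.domain, A.integrand z = 1) (hBi : ∀ z ∈ B.domain, B.integrand z = 1) :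
    ∃ K : IntegralRep (n + 1), Bornology.IsBounded K.domain ∧ (∀ z ∈ K.domain, K.integrand z = 1) ∧
      of A + of B - of K ∈ relations := by
  obtain ⟨C, hC⟩ := isBounded_iff_forall_norm_le.mp (hA.union hB)
  set R₀ : ℕ := ⌈C⌉₊ + 1 with hR₀
  have hCR : C < R₀ := by
    rw [hR₀, Nat.cast_add, Nat.cast_one]
    exact (Nat.le_ceil C).trans_lt (lt_add_one _)
  set v : Fin (n + 1) → ℚ := fun i => if i = 0 then 2 * (R₀ : ℚ) else 0 with hv
  obtain ⟨B', hB'd, hB'i, hrel⟩ := exists_translate B v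
  have hw0 : ((v 0 : ℚ) : ℝ) = 2 * R₀ := by simp [hv]
  have hwle : ∀ i, |((v i : ℚ) : ℝ)| ≤ 2 * R₀ := fun i => by
    by_cases hi : i = 0
    · simp [hv, hi]
    · simp [hv, hi]
  have hB'b : Bornology.IsBounded B'.domain := by
    refine isBounded_iff_forall_norm_le.mpr ⟨C + 2 * R₀, fun z hz => ?_⟩
    rw [hB'd] at hz
    have hzC := hC _ (Or.inr hz)
    have hC0 : 0 ≤ C := (norm_nonneg _).trans hzC
    refine (pi_norm_le_iff_of_nonneg (by positivity)).mpr fun i => ?_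
    have h1 : |z i - (v i : ℝ)| ≤ C := by
      simpa [Real.norm_eq_abs] using (norm_le_pi_norm (z - fun i => (v i : ℝ)) i).trans hzC
    rw [Real.norm_eq_abs]
    have h2 := hwle i
    rw [abs_le] at h1 h2 ⊢
    constructor <;> linarith
  have hB'1 : ∀ z ∈ B'.domain, B'.integrand z = 1 := fun z hz => by
    rw [hB'i]
    rw [hB'd] at hz
    exact hBi _ hz
  have hdisj : Disjoint A.domain B'.domain := by
    rw [Set.disjoint_left]
    intro z hzA hzB
    rw [hB'd] at hzB
    have h1 : |z 0| ≤ C := by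
      simpa [Real.norm_eq_abs] using (norm_le_pi_norm z 0).trans (hC z (Or.inl hzA))
    have h2 : |z 0 - 2 * R₀| ≤ C := by
      have := (norm_le_pi_norm (z - fun i => (v i : ℝ)) 0).trans (hC _ (Or.inr hzB))
      simpa [Real.norm_eq_abs, hw0] using this
    rw [abs_le] at h1 h2
    linarith
  refine ⟨A.glue B' hdisj, hA.union hB'b, fun z hz => ?_, ?_⟩
  · rcases hz with hz | hz
    · rw [IntegralRep.eqOn_integrand_glue_left A B' hdisj hz, hAi z hz]
    · rw [IntegralRep.eqOn_integrand_glue_right A B' hdisj hz, hB'1 z hz]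
  · have h1 := domainAddRel_subset_relations (IntegralRep.of_glue_sub_sub_mem_domainAddRel A B' hdisj)
    have h2 := changeOfVariablesRel_subset_relations hrel
    have : of A + of B - of (A.glue B' hdisj) = (of B - of B') - (of (A.glue B' hdisj) - of A - of B') := by
      abel
    rw [this]
    exact relations.sub_mem h2 h1

/-- **Finitely many bounded volumes merge into one** (iterate `exists_merge₂`): for a finite family
`Aᵢ` of representations of dimension `n + 1` with bounded domains and integrand `1` there is one
such `K` with `∑ᵢ [Aᵢ] − [K] ∈ relations`. [Viu-Sos 2021, Cor. 2.3] [cite: ViuSos2021, Cor. 2.3] -/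
theorem exists_merge {ι : Type*} (s : Finset ι) (A : ι → IntegralRep (n + 1))
    (hc : ∀ i ∈ s, Bornology.IsBounded (A i).domain)
    (hi : ∀ i ∈ s, ∀ z ∈ (A i).domain, (A i).integrand z = 1) :
    ∃ K : IntegralRep (n + 1), Bornology.IsBounded K.domain ∧ (∀ z ∈ K.domain, K.integrand z = 1) ∧
      ∑ i ∈ s, of (A i) - of K ∈ relations := by
  classical
  induction s using Finset.induction_on with
  | empty =>
    refine ⟨IntegralRep.empty _, Bornology.isBounded_empty, fun _ h => h.elim, ?_⟩
    simpa using relations.neg_mem IntegralRep.of_empty_mem_relations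
  | insert a s ha ih =>
    obtain ⟨K', hK'c, hK'i, hK'⟩ := ih (fun i his => hc i (Finset.mem_insert_of_mem his))
      (fun i his => hi i (Finset.mem_insert_of_mem his))
    obtain ⟨K, hKc, hKi, hK⟩ := exists_merge₂ (A a) K' (hc a (Finset.mem_insert_self a s)) hK'c
      (hi a (Finset.mem_insert_self a s)) hK'i
    refine ⟨K, hKc, hKi, ?_⟩
    rw [Finset.sum_insert ha]
    have : of (A a) + ∑ i ∈ s, of (A i) - of K = (∑ i ∈ s, of (A i) - of K') +
        (of (A a) + of K' - of K) := by abel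
    rw [this]
    exact relations.add_mem hK' hK

/-! ### Step (a): compactification of the domain at the level of moves [Viu-Sos 2021, Thm. 2.1] -/

section Compactify

open PeriodCompactify

/-- The coordinate inversion `inv T` is a `ℚ`-semialgebraic map on the piece domain (its components
are `vᵢ` or `1/vᵢ`, `vᵢ ≠ 0` there). [cite: ViuSos2021, Thm. 2.1] -/
theorem isSemialgebraicMapOn_inv_pieceDom (T : Finset (Fin n)) {σ : Set (Fin n → ℝ)}
    (hσ : IsSemialgebraic ℚ σ) : IsSemialgebraicMapOn ℚ (pieceDom T σ) (inv T) := by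
  have hD := isSemialgebraic_pieceDom T hσ
  refine IsSemialgebraicMapOn.of_forall hD fun i => ?_
  by_cases hi : i ∈ T
  · refine (isSemialgebraicFunOn_aeval_div_aeval hD (1 : MvPolynomial (Fin n) ℚ) (X i)
      fun v hv => ?_).congr fun v _ => ?_
    · simpa using ne_zero_of_mem_inner T hv.1 hi
    · simp [inv_apply_of_mem T hi]
  · simpa [inv_apply_of_not_mem T hi] using isSemialgebraicFunOn_apply hD i

/-- **Step (a) [Viu-Sos 2021, Thm. 2.1 / Cor. 2.1] at the level of moves.** A representation of
KZ's literal rational shape `r = (σ, p/q)` differs by relations from the sum of the `2ⁿ` rational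
representations `(pieceDom T σ, pieceNum T p q / pieceDen T p q)` of `PeriodCompactDomain.lean`, whose
domains lie in `[-1, 1]ⁿ`: split `σ` along the outer regions (rule (1); the complement of their
union is null) and change variables by the involutive chart `inv T` on each piece (rule (2)).
[cite: ViuSos2021, Thm. 2.1 and Cor. 2.1] -/
theorem exists_sub_sum_bounded_mem_relations (r : IntegralRep n) (hr : r.IsRational) :
    ∃ R : Finset (Fin n) → IntegralRep n,
      (∀ T, (R T).IsRational ∧ Bornology.IsBounded (R T).domain) ∧
      of r - ∑ T, of (R T) ∈ relations := by
  obtain ⟨p, q, hq, hpq⟩ := hr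
  have hσ := r.isSemialgebraic_domain
  have hint : IntegrableOn (fun y => aeval y p / aeval y q) r.domain :=
    r.integrableOn.congr_fun hpq (IntegralRep.measurableSet_domain_holds r)
  set R : Finset (Fin n) → IntegralRep n := fun T => IntegralRep.ofRational (pieceDom T r.domain)
    (pieceNum T p q) (pieceDen T p q) (isSemialgebraic_pieceDom T hσ) (pieceDen_ne_zero T hq)
    (integrableOn_piece T hσ hq hint) with hR
  refine ⟨R, fun T => ⟨IntegralRep.isRational_ofRational _ _ _ _ _ _, isBounded_pieceDom T⟩, ?_⟩
  -- the traces of `r` on the outer regions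
  have hS : ∀ T, IsSemialgebraic ℚ (r.domain ∩ outer T) := fun T => hσ.inter (isSemialgebraic_outer T)
  set S : Finset (Fin n) → IntegralRep n := fun T => r.restrict _ (hS T) inter_subset_left with hS'
  have e1 : of r - ∑ T, of (S T) ∈ relations := by
    refine of_sub_sum_of_mem_relations Finset.univ r S (fun T _ => ?_) (fun T _ _ _ => rfl) ?_ ?_
    · rw [show (S T).domain \ r.domain = ∅ from sdiff_eq_empty.mpr inter_subset_left, measure_empty]
    · refine measure_mono_null (fun x hx => ?_) volume_compl_iUnion_outer
      intro hx'
      obtain ⟨T, hT⟩ := mem_iUnion.1 hx'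
      exact hx.2 (mem_biUnion (Finset.mem_univ T) ⟨hx.1, hT⟩)
    · intro T hT T' hT' hne
      rw [show (S T).domain ∩ (S T').domain = ∅ from
        Set.disjoint_iff_inter_eq_empty.mp (pairwiseDisjoint_outer r.domain hT hT' hne), measure_empty]
  -- each chart is a change-of-variables move
  have e2 : ∀ T, of (R T) - of (S T) ∈ changeOfVariablesRel := fun T =>
    ⟨n, R T, S T, inv T, invDeriv T, isSemialgebraicMapOn_inv_pieceDom T hσ,
      hasFDerivWithinAt_inv_pieceDom T, injOn_inv_pieceDom T, (image_inv_pieceDom T).symm,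
      fun v hv => by
        rw [hS', IntegralRep.integrand_restrict, hpq (show inv T v ∈ r.domain from hv.2), hR,
          IntegralRep.integrand_ofRational, mul_comm]
        exact (integrand_piece_eq T hq hv).symm, rfl⟩
  have e3 := sum_sub_sum_mem_relations Finset.univ _ _ fun T _ =>
    changeOfVariablesRel_subset_relations (e2 T)
  have : of r - ∑ T, of (R T) = (of r - ∑ T, of (S T)) - (∑ T, of (R T) - ∑ T, of (S T)) := by abel
  rw [this]
  exact relations.sub_mem e1 e3

end Compactify

/-! ### Thm. 1.1 from the bounded reduction / from separation of poles -/

/-- **The positive case of Thm. 1.1, granted the bounded reduction in dimension `d`.** If `H` holds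
in dimension `d` — every representation of KZ's literal rational shape on a bounded domain differs
by relations from a finite sum of representations of the same dimension with BOUNDED domains and
BOUNDED integrands — then a rational representation `r` in dimension `d` with `r.value > 0` differs by relations from `∫_K 1`
for a compact `K ⊂ ℝ^{d+1}` with non-empty interior: compactify the domain
(`exists_sub_sum_bounded_mem_relations`), apply `H`, pass to differences of bounded volumes
(`exists_sub_of_isBounded`), merge (`exists_merge`) into `[K₁] − [K₂]` with
`vol K₁ − vol K₂ = r.value > 0` (soundness of the moves), and subtract
(`exists_isCompact_of_sub_of_sub_mem_relations`). [cite: ViuSos2021, Thm. 1.1] -/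
theorem exists_isCompact_of_value_pos {d : ℕ}
    (H : ∀ r : IntegralRep d, r.IsRational → Bornology.IsBounded r.domain →
      ∃ (k : ℕ) (R : Fin k → IntegralRep d), (∀ j, Bornology.IsBounded (R j).domain ∧
        ∃ M : ℝ, ∀ x ∈ (R j).domain, |(R j).integrand x| ≤ M) ∧ of r - ∑ j, of (R j) ∈ relations)
    (r : IntegralRep d) (hr : r.IsRational) (hpos : 0 < r.value) :
    ∃ K : IntegralRep (d + 1), IsCompact K.domain ∧ (interior K.domain).Nonempty ∧
      (∀ z ∈ K.domain, K.integrand z = 1) ∧ of r - of K ∈ relations := by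
  classical
  -- (a) bounded domains
  obtain ⟨R, hR, ea⟩ := exists_sub_sum_bounded_mem_relations r hr
  -- (b) bounded domains and integrands
  choose k R' hR' eb using fun T => H (R T) (hR T).1 (hR T).2
  have hM : ∀ T j, ∃ M : ℝ, ∀ x ∈ (R' T j).domain, |(R' T j).integrand x| ≤ M := fun T j => (hR' T j).2
  choose M hM using hM
  -- (c) differences of bounded volumes
  choose A B hAc hBc hAi hBi ec using fun T j => exists_sub_of_isBounded (R' T j) (hR' T j).1 (hM T j)
  -- merge over the index set `Σ T, Fin (k T)`
  set ι := Σ T : Finset (Fin d), Fin (k T)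
  obtain ⟨K₁, h₁c, h₁i, e₁⟩ := exists_merge (Finset.univ : Finset ι) (fun i => A i.1 i.2)
    (fun i _ => hAc i.1 i.2) (fun i _ => hAi i.1 i.2)
  obtain ⟨K₂, h₂c, h₂i, e₂⟩ := exists_merge (Finset.univ : Finset ι) (fun i => B i.1 i.2)
    (fun i _ => hBc i.1 i.2) (fun i _ => hBi i.1 i.2)
  -- bookkeeping: [r] ≡ [K₁] − [K₂]
  have eb' : ∑ T, of (R T) - ∑ T, ∑ j, of (R' T j) ∈ relations :=
    sum_sub_sum_mem_relations _ _ _ fun T _ => eb T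
  have ec' : ∑ T, ∑ j, of (R' T j) - ∑ T, ∑ j, (of (A T j) - of (B T j)) ∈ relations :=
    sum_sub_sum_mem_relations _ _ _ fun T _ => sum_sub_sum_mem_relations _ _ _ fun j _ => ec T j
  have hsumA : ∑ i : ι, of (A i.1 i.2) = ∑ T, ∑ j, of (A T j) := by
    rw [← Finset.univ_sigma_univ, Finset.sum_sigma]
  have hsumB : ∑ i : ι, of (B i.1 i.2) = ∑ T, ∑ j, of (B T j) := by
    rw [← Finset.univ_sigma_univ, Finset.sum_sigma]
  have hsum : ∑ T, ∑ j, (of (A T j) - of (B T j)) = ∑ i : ι, of (A i.1 i.2) - ∑ i : ι, of (B i.1 i.2) := by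
    rw [hsumA, hsumB, ← Finset.sum_sub_distrib]
    exact Finset.sum_congr rfl fun T _ => Finset.sum_sub_distrib _ _
  have e12 : of r - (of K₁ - of K₂) ∈ relations := by
    have : of r - (of K₁ - of K₂) = (of r - ∑ T, of (R T)) + (∑ T, of (R T) - ∑ T, ∑ j, of (R' T j)) +
        (∑ T, ∑ j, of (R' T j) - ∑ T, ∑ j, (of (A T j) - of (B T j))) +
        (∑ i : ι, of (A i.1 i.2) - of K₁) - (∑ i : ι, of (B i.1 i.2) - of K₂) := by
      rw [hsum]; abel
    rw [this]
    exact relations.sub_mem (relations.add_mem (relations.add_mem (relations.add_mem ea eb') ec') e₁) e₂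
  -- volumes by soundness, and step (d)
  have hlt : K₂.value < K₁.value := by
    have h0 := relations_le_ker_eval_holds e12
    rw [AddMonoidHom.mem_ker, map_sub, map_sub, eval_of, eval_of, eval_of] at h0
    linarith
  obtain ⟨K, hKc, hKint, hKi, hK⟩ :=
    exists_isCompact_of_sub_of_sub_mem_relations K₁ K₂ h₁c h₂c h₁i h₂i hlt
  refine ⟨K, hKc, hKint, hKi, ?_⟩
  have : of r - of K = (of r - (of K₁ - of K₂)) + (of K₁ - of K₂ - of K) := by abel
  rw [this]
  exact relations.add_mem e12 hK

/-- The negative of a rational representation is rational. [folklore] -/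
theorem IntegralRep.IsRational.neg {d : ℕ} {r : IntegralRep d} (hr : r.IsRational) : r.neg.IsRational := by
  obtain ⟨p, q, hq, hpq⟩ := hr
  exact ⟨-p, q, hq, fun x hx => by simp [hpq hx, neg_div]⟩

/-- **Viu-Sos' semi-canonical reduction (Thm. 1.1) from the bounded reduction.** Hypothesis `H`:
*every integral representation of KZ's literal rational shape on a bounded domain differs by
relations from a finite sum of representations of the same dimension with bounded domains and
bounded integrands.* This is the output of step (b) of the printed proof read over the calculus —
Viu-Sos 2021, Cor. 2.2 (proved there from Prop. 2.2 by Hironaka's embedded resolution of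
singularities, Thm. 2.2, applied to `∂_z S ∪ {P = 0} ∪ {Q = 0}`, with the compact partition of `ℙ^m`
of Prop. 2.1 to stay in affine charts): a rational function without poles on a compact domain is
bounded there (`semiCanonicalReduction_of_separationOfPoles`). Granted `H`, the fact
`KZ.semiCanonicalReduction` follows by steps (a), (c), (d) of this file
(`exists_isCompact_of_value_pos`), applied to `r` if `r.value > 0` and to `r.neg` if
`r.value < 0` (`[r] + [r.neg]` is a relation). `H` is an explicit hypothesis and is NOT asserted
here; it is the same reduction that `PeriodCompactDomain.lean`
(`isComputableReal_of_isRealPeriod_of_separationOfPoles`) takes as hypothesis at the level of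
values. [cite: ViuSos2021, Thm. 1.1 (with Cor. 2.2 as hypothesis)] -/
theorem semiCanonicalReduction_of_boundedReduction
    (H : ∀ ⦃n : ℕ⦄ (r : IntegralRep n), r.IsRational → Bornology.IsBounded r.domain →
      ∃ (k : ℕ) (R : Fin k → IntegralRep n), (∀ j, Bornology.IsBounded (R j).domain ∧
        ∃ M : ℝ, ∀ x ∈ (R j).domain, |(R j).integrand x| ≤ M) ∧ of r - ∑ j, of (R j) ∈ relations) :
    semiCanonicalReduction := by
  intro d r hr hne
  rcases lt_or_gt_of_ne hne with hneg | hpos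
  · have hpos' : 0 < r.neg.value := by
      rw [IntegralRep.value_neg]
      linarith
    obtain ⟨K, hKc, hKint, hKi, hK⟩ := exists_isCompact_of_value_pos (@H d) r.neg hr.neg hpos'
    refine ⟨d + 1, K, Nat.succ_pos d, le_rfl, hKc, hKint, hKi, fun h => absurd hneg (lt_asymm h),
      fun _ => ?_⟩
    have : of r + of K = (of r + of r.neg) - (of r.neg - of K) := by abel
    rw [this]
    exact relations.sub_mem (levelRel_le_relations (of_add_of_neg_mem_levelRel r)) hK
  · obtain ⟨K, hKc, hKint, hKi, hK⟩ := exists_isCompact_of_value_pos (@H d) r hr hpos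
    exact ⟨d + 1, K, Nat.succ_pos d, le_rfl, hKc, hKint, hKi, fun _ => hK,
      fun h => absurd hpos (lt_asymm h)⟩

/-- **Viu-Sos' semi-canonical reduction (Thm. 1.1) from separation of poles** in the printed form
of Viu-Sos 2021, Cor. 2.2 over the calculus: *every integral representation of KZ's literal
rational shape on a bounded domain differs by relations from a finite sum of rational
representations of the same dimension on COMPACT domains* ("well-defined rational functions over
compact semialgebraic sets": the denominators do not vanish on the closed domains, so the integrands
are continuous and bounded there). This is the special case of
`semiCanonicalReduction_of_boundedReduction` in which the pieces are rational and compact. The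
hypothesis is Hironaka-based (Thm. 2.2, Prop. 2.2 of the source) and is NOT asserted here.
[cite: ViuSos2021, Thm. 1.1 (with Cor. 2.2 as hypothesis)] -/
theorem semiCanonicalReduction_of_separationOfPoles
    (H : ∀ ⦃n : ℕ⦄ (r : IntegralRep n), r.IsRational → Bornology.IsBounded r.domain →
      ∃ (k : ℕ) (R : Fin k → IntegralRep n), (∀ j, (R j).IsRational ∧ IsCompact (R j).domain) ∧
        of r - ∑ j, of (R j) ∈ relations) :
    semiCanonicalReduction := by
  refine semiCanonicalReduction_of_boundedReduction fun n r hr hb => ?_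
  obtain ⟨k, R, hR, hrel⟩ := H r hr hb
  refine ⟨k, R, fun j => ⟨(hR j).2.isBounded, ?_⟩, hrel⟩
  obtain ⟨p, q, hq, hpq⟩ := (hR j).1
  have hfc : ContinuousOn (fun x => aeval x p / aeval x q) (R j).domain :=
    (continuous_aeval_of_algebra p).continuousOn.div (continuous_aeval_of_algebra q).continuousOn hq
  obtain ⟨M, hM⟩ := (hR j).2.exists_bound_of_continuousOn (hfc.congr hpq)
  exact ⟨M, fun x hx => by simpa [Real.norm_eq_abs] using hM x hx⟩

end KZ

end Literature.NumberTheory.Transcendental
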